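import Mathlib
import Summits.Ventures.FusionMHD.Models.FluxSurfacePolarRayGlue
import HarnessLib

/-!
# Polar-ray DERIVATIVE: the glued ray radius `ρ(θ)` is differentiable on a panel, with
# `ρ′(θ) = −∂_θψ(ray)/∂_sψ(ray) = −ρ(θ)·D_t(θ)/D_r(θ)` — the `ρ`-regularity lemma that lets ★ #88's
# `safetyFactorE_eq_polar` read the glue's θ-integral bracket as `(2π/F)·q`

LADDER-GRIDFUSION (F2 item R2), cell `gridfusion`, seat `gridfusion-model-7` (g3), 2026-08-27; lead g6 RULING 7w (1) (LOW, no count,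
0 kit) on referee ref-3's LEDGER-3 row 50, scope line (b): «reading the bracket as (2π/F)·q via #88's `safetyFactorE_eq_polar` needs ρ
differentiable, which the glue does not claim — one lemma «ψ C¹ near the loop ∧ D_r ≠ 0 ⇒ ρ C¹ on the panel» would close it for every
surface at once».  Companion of `Models/FluxSurfacePolarRay.lean` (#88, p530205: the cancellation and `(6.35)` as a θ-integral for a
DIFFERENTIABLE radius `ρ`) and `Models/FluxSurfacePolarRayGlue.lean` (p533734: the glued radius `rayRadius := sInf {s > 0 | ψ(ray s) = u}`,
its bracket, CONTINUITY on a panel, the θ-integral bracket).  Own file only because an append would break the 400-line rule; nothing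
in those files changes.  Elementary real analysis, [folklore]; no equilibrium, no device.

WHAT IS PROVED (arbitrary `ψ : ℝ → ℝ → ℝ`, centre `(R_c, Z_c)`, level `u`; `ρ := rayRadius ψ R_c Z_c u`):
* §1 `hasDerivWithinAt_of_implicit` — IMPLICIT DIFFERENTIATION FROM CONTINUITY: `F : ℝ × ℝ → ℝ` Fréchet-differentiable AT THE
  POINT `(x₀, g x₀)` with `∂₂F = L(0,1) ≠ 0`, `g` continuous at `x₀` within `S` and solving `F(x, g x) = F(x₀, g x₀)` near `x₀`
  within `S` ⇒ `HasDerivWithinAt g (−L(1,0)/L(0,1)) S x₀` (linearise along the curve `x ↦ (x, g x)`; the non-vanishing `∂₂F`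
  bootstraps `|g x − g x₀| = O(|x − x₀|)`, then the remainder is `o(|x − x₀|)`); two-sided version `hasDerivAt_of_implicit`.
* §2 `hasFDerivAt_rayProfile` — chain rule: if `ψ` is Fréchet-differentiable at the ray point with derivative `Lψ`, the uncurried
  ray profile `(θ, s) ↦ ψ(ray_θ s)` has derivative `Lψ ∘ rayMapDeriv θ s`, whose partials are `∂_θ = s·D_t` and `∂_s = D_r`
  (`rayProfile_partial_theta/_s`; `D_r`, `D_t` = #88's `radialDeriv`, `tangentialDeriv` of `(ψ_R, ψ_Z) = (Lψ(1,0), Lψ(0,1))`).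
* §3 ON A PANEL `[a, b] × [s₁, s₂]` under the glue's hypotheses (`hin`: profile `< u` on `(0, s₁]`; `hF`: joint continuity;
  `hmono`: strictly increasing on the bracket; `hout`: `> u` at `s₂`): `hasDerivWithinAt_rayRadius` — if the uncurried profile is
  differentiable at `(θ₀, ρ(θ₀))` with `∂_s ≠ 0` then `HasDerivWithinAt ρ (−∂_θ/∂_s) [a, b] θ₀` (endpoints included; interior
  points: `hasDerivAt_rayRadius`); in `ψ`'s vocabulary `hasDerivWithinAt_rayRadius_of_psi` / `hasDerivAt_rayRadius_of_psi`:
  `ρ′(θ₀) = −ρ(θ₀)·D_t(θ₀)/D_r(θ₀)` whenever `ψ` is differentiable at `γ(θ₀)` with `D_r(θ₀) ≠ 0` — the differentiated level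
  condition `ρ′D_r + ρD_t = 0` of #88's header, now for the GLUED `ρ`; `hasDerivAt_level_rayRadius`: `θ ↦ ψ(γ(θ))` has
  derivative `0` inside the panel (#88's hypothesis `hlevel`).
The whole-loop consequences (periodic seam at `θ = 0 ≡ 2π`, `ρ ∈ C¹[a, b]` for `ψ ∈ C¹` near the loop, and #88's `(6.35)` identity
`q = (F/2π)∫₀^{2π} ρ/(R·|D_r|) dθ` for the glued `ρ`) are in the companion `Models/FluxSurfacePolarRayLoop.lean`.
DESIGN.  Mathlib's `implicitFunctionOfBivariate` / `HasStrictFDerivAt.implicitFunctionOfProdDomain` and the tree's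
`Literature.Analysis.Calculus.LevelSetTangentFamilies.contDiffOn_implicitFunction_nhds` CONSTRUCT a local root function from strict
differentiability / C¹ data and would still need an identification step with `rayRadius`; here the root function already exists
(the glue's `sInf`) and is already continuous (`PolarRay.continuousOn_rayRadius`), so only its differentiability is at stake, and that
needs `ψ` differentiable AT THE LOOP POINT only — strictly weaker hypotheses, no identification step.  In certificate terms: the
panel files already certify `∂_sψ(ray) = D ≥ d⁻ > 0` on panel × bracket, which is exactly `∂_s ≠ 0`.
MODELLED: nothing.  NOT CLAIMED: any value for any equilibrium; that an instance's code-list field `D` IS `∂_sψ(ray)` (a per-instance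
kernel fact, ref-3 row 50 scope (a)).
-/

noncomputable section

open Real Set Filter Topology Asymptotics
open Literature.MathematicalPhysics.MHD.GradShafranov

namespace Summit.Ventures.FusionMHD.Models

namespace PolarRay

/-! ## §1 Implicit differentiation from continuity (one real equation, one real unknown) -/

/-- **IMPLICIT DIFFERENTIATION FROM CONTINUITY.**  Let `F : ℝ × ℝ → ℝ` be Fréchet-differentiable at `(x₀, g x₀)` with
derivative `L`, `L (0, 1) ≠ 0` (non-vanishing partial in the unknown), and let `g` be continuous at `x₀` within `S` and solve
`F (x, g x) = F (x₀, g x₀)` for `x` near `x₀` within `S`.  Then `g` has derivative `−L(1,0)/L(0,1)` at `x₀` within `S`.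
(Only differentiability AT THE POINT and continuity of the root are used — no implicit-function theorem, no strict
differentiability: the linearisation forces `|g x − g x₀| = O(|x − x₀|)`, then the remainder is `o(|x − x₀|)`.) [folklore] -/
theorem hasDerivWithinAt_of_implicit {F : ℝ × ℝ → ℝ} {g : ℝ → ℝ} {S : Set ℝ} {x₀ : ℝ} {L : ℝ × ℝ →L[ℝ] ℝ}
    (hg : ContinuousWithinAt g S x₀) (hlevel : ∀ᶠ x in 𝓝[S] x₀, F (x, g x) = F (x₀, g x₀))
    (hF : HasFDerivAt F L (x₀, g x₀)) (hq : L (0, 1) ≠ 0) :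
    HasDerivWithinAt g (-(L (1, 0)) / L (0, 1)) S x₀ := by
  set p : ℝ := L (1, 0) with hp
  set q : ℝ := L (0, 1) with hq'
  -- L (a, b) = p a + q b
  have hL : ∀ a b : ℝ, L (a, b) = p * a + q * b := by
    intro a b
    have e : ((a, b) : ℝ × ℝ) = a • ((1 : ℝ), (0 : ℝ)) + b • ((0 : ℝ), (1 : ℝ)) := by ext <;> simp
    rw [e, map_add, map_smul, map_smul, smul_eq_mul, smul_eq_mul]; ring
  -- the curve x ↦ (x, g x) tends to the base point within S
  have htend : Tendsto (fun x => ((x, g x) : ℝ × ℝ)) (𝓝[S] x₀) (𝓝 (x₀, g x₀)) :=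
    (continuousWithinAt_id.prodMk hg).tendsto
  -- linearisation along the curve: L(x − x₀, g x − g x₀) = o(‖(x − x₀, g x − g x₀)‖)
  have h1 : (fun x => F (x, g x) - F (x₀, g x₀) - L ((x, g x) - (x₀, g x₀)))
      =o[𝓝[S] x₀] (fun x => ((x, g x) : ℝ × ℝ) - (x₀, g x₀)) := hF.isLittleO.comp_tendsto htend
  have h2 : (fun x => p * (x - x₀) + q * (g x - g x₀)) =o[𝓝[S] x₀] (fun x => ((x, g x) : ℝ × ℝ) - (x₀, g x₀)) := by
    have h1' := h1.neg_left
    refine h1'.congr' ?_ (Eventually.of_forall fun _ => rfl)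
    filter_upwards [hlevel] with x hx
    simp only [hx, sub_self, zero_sub, neg_neg, Prod.mk_sub_mk, hL]
  -- bootstrap: ‖(x − x₀, g x − g x₀)‖ ≤ C |x − x₀|
  have hqpos : 0 < |q| := abs_pos.2 hq
  have h3 : (fun x => ((x, g x) : ℝ × ℝ) - (x₀, g x₀)) =O[𝓝[S] x₀] (fun x => x - x₀) := by
    refine IsBigO.of_bound (1 + 2 * |p| / |q|) ?_
    filter_upwards [h2.def (half_pos hqpos)] with x hx
    simp only [Prod.mk_sub_mk] at hx ⊢
    set a := x - x₀
    set b := g x - g x₀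
    rw [Prod.norm_def] at hx ⊢
    simp only [Real.norm_eq_abs] at hx ⊢
    have hpa : |p * a| = |p| * |a| := abs_mul p a
    have hqb : |q * b| = |q| * |b| := abs_mul q b
    -- |q||b| ≤ |p a + q b| + |p||a|
    have htri : |q| * |b| ≤ |p * a + q * b| + |p| * |a| := by
      rw [← hqb, ← hpa]
      have := abs_sub (p * a + q * b) (p * a)
      simp only [add_sub_cancel_left] at this
      linarith [abs_sub_comm (p * a + q * b) (p * a)]
    have hC : 0 ≤ 2 * |p| / |q| := by positivity
    rcases le_or_gt |b| |a| with hba | hab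
    · rw [max_eq_left hba]
      nlinarith [abs_nonneg a]
    · rw [max_eq_right hab.le] at hx ⊢
      -- |q||b| ≤ |q|/2 |b| + |p||a| ⇒ |b| ≤ 2|p|/|q| |a|
      have hb : |q| * |b| ≤ 2 * (|p| * |a|) := by linarith
      have hb' : |b| ≤ 2 * |p| / |q| * |a| := by
        rw [div_mul_eq_mul_div, le_div_iff₀ hqpos]
        linarith
      linarith [abs_nonneg a]
  have h4 : (fun x => p * (x - x₀) + q * (g x - g x₀)) =o[𝓝[S] x₀] (fun x => x - x₀) := h2.trans_isBigO h3
  -- conclude: g x − g x₀ − (x − x₀)(−p/q) = q⁻¹ (p (x − x₀) + q (g x − g x₀))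
  rw [hasDerivWithinAt_iff_isLittleO]
  refine (h4.const_mul_left q⁻¹).congr' ?_ (Eventually.of_forall fun _ => rfl)
  refine Eventually.of_forall fun x => ?_
  simp only [smul_eq_mul]
  field_simp
  ring

/-- The two-sided version: `g` continuous at `x₀`, `F (x, g x) = F (x₀, g x₀)` near `x₀`, `F` differentiable at the point
with `L (0,1) ≠ 0` ⇒ `HasDerivAt g (−L(1,0)/L(0,1)) x₀`. [folklore] -/
theorem hasDerivAt_of_implicit {F : ℝ × ℝ → ℝ} {g : ℝ → ℝ} {x₀ : ℝ} {L : ℝ × ℝ →L[ℝ] ℝ}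
    (hg : ContinuousAt g x₀) (hlevel : ∀ᶠ x in 𝓝 x₀, F (x, g x) = F (x₀, g x₀))
    (hF : HasFDerivAt F L (x₀, g x₀)) (hq : L (0, 1) ≠ 0) :
    HasDerivAt g (-(L (1, 0)) / L (0, 1)) x₀ := by
  rw [← hasDerivWithinAt_univ]
  exact hasDerivWithinAt_of_implicit hg.continuousWithinAt (by rwa [nhdsWithin_univ]) hF hq

/-! ## §2 The ray profile as a function of `(θ, s)`: Fréchet derivative from `ψ`'s, with partials `(s·D_t, D_r)` -/

/-- Derivative of the ray map `(θ, s) ↦ (R_c + s cos θ, Z_c + s sin θ)` at `(θ, s)`: the linear map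
`(a, b) ↦ a·(−s sin θ, s cos θ) + b·(cos θ, sin θ)`. [folklore] -/
def rayMapDeriv (θ s : ℝ) : ℝ × ℝ →L[ℝ] ℝ × ℝ :=
  (ContinuousLinearMap.fst ℝ ℝ ℝ).smulRight (-(s * sin θ), s * cos θ)
    + (ContinuousLinearMap.snd ℝ ℝ ℝ).smulRight (cos θ, sin θ)

/-- `rayMapDeriv θ s (a, b) = (−a s sin θ + b cos θ, a s cos θ + b sin θ)`. [folklore] -/
@[simp] theorem rayMapDeriv_apply (θ s a b : ℝ) :
    rayMapDeriv θ s (a, b) = (-(a * (s * sin θ)) + b * cos θ, a * (s * cos θ) + b * sin θ) := by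
  simp [rayMapDeriv, smul_eq_mul]

/-- The ray map `(θ, s) ↦ rayPoint R_c Z_c θ s` is Fréchet-differentiable everywhere with derivative `rayMapDeriv θ s`.
[folklore] -/
theorem hasFDerivAt_rayPoint (Rc Zc θ s : ℝ) :
    HasFDerivAt (fun p : ℝ × ℝ => rayPoint Rc Zc p.1 p.2) (rayMapDeriv θ s) (θ, s) := by
  have h1 : HasFDerivAt (fun p : ℝ × ℝ => Rc + p.2 * cos p.1)
      ((s : ℝ) • (-sin θ • ContinuousLinearMap.fst ℝ ℝ ℝ) + cos θ • ContinuousLinearMap.snd ℝ ℝ ℝ) (θ, s) := by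
    have := ((hasFDerivAt_snd (𝕜 := ℝ) (E := ℝ) (F := ℝ) (p := (θ, s))).mul
      ((hasFDerivAt_fst (𝕜 := ℝ) (E := ℝ) (F := ℝ) (p := (θ, s))).cos)).const_add Rc
    simpa using this
  have h2 : HasFDerivAt (fun p : ℝ × ℝ => Zc + p.2 * sin p.1)
      ((s : ℝ) • (cos θ • ContinuousLinearMap.fst ℝ ℝ ℝ) + sin θ • ContinuousLinearMap.snd ℝ ℝ ℝ) (θ, s) := by
    have := ((hasFDerivAt_snd (𝕜 := ℝ) (E := ℝ) (F := ℝ) (p := (θ, s))).mul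
      ((hasFDerivAt_fst (𝕜 := ℝ) (E := ℝ) (F := ℝ) (p := (θ, s))).sin)).const_add Zc
    simpa using this
  have h := h1.prodMk h2
  refine h.congr_fderiv ?_
  ext <;> simp [rayMapDeriv, smul_eq_mul]

/-- **CHAIN RULE FOR THE RAY PROFILE.**  If `ψ` is Fréchet-differentiable at the ray point with derivative `Lψ`, the
uncurried ray profile `(θ, s) ↦ ψ(ray_θ s)` is Fréchet-differentiable at `(θ, s)` with derivative `Lψ ∘ rayMapDeriv θ s`.
[folklore] -/
theorem hasFDerivAt_rayProfile {ψ : ℝ → ℝ → ℝ} {Rc Zc θ s : ℝ} {Lψ : ℝ × ℝ →L[ℝ] ℝ}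
    (hψ : HasFDerivAt (fun p : ℝ × ℝ => ψ p.1 p.2) Lψ (rayPoint Rc Zc θ s)) :
    HasFDerivAt (fun p : ℝ × ℝ => rayProfile ψ Rc Zc p.1 p.2) (Lψ.comp (rayMapDeriv θ s)) (θ, s) := by
  have h := hψ.comp (θ, s) (hasFDerivAt_rayPoint Rc Zc θ s)
  exact h

/-- Its `θ`-partial is `s · D_t`: `(Lψ ∘ rayMapDeriv θ s)(1, 0) = s · tangentialDeriv ψ_R ψ_Z θ`. [folklore] -/
theorem rayProfile_partial_theta {θ s : ℝ} (Lψ : ℝ × ℝ →L[ℝ] ℝ) :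
    (Lψ.comp (rayMapDeriv θ s)) (1, 0) = s * tangentialDeriv (Lψ (1, 0)) (Lψ (0, 1)) θ := by
  rw [ContinuousLinearMap.comp_apply, rayMapDeriv_apply]
  have e : ((-(1 * (s * sin θ)) + 0 * cos θ, 1 * (s * cos θ) + 0 * sin θ) : ℝ × ℝ)
      = (-(s * sin θ)) • ((1 : ℝ), (0 : ℝ)) + (s * cos θ) • ((0 : ℝ), (1 : ℝ)) := by ext <;> simp
  rw [e, map_add, map_smul, map_smul, smul_eq_mul, smul_eq_mul]
  unfold tangentialDeriv
  ring

/-- Its `s`-partial is `D_r`: `(Lψ ∘ rayMapDeriv θ s)(0, 1) = radialDeriv ψ_R ψ_Z θ`. [folklore] -/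
theorem rayProfile_partial_s {θ s : ℝ} (Lψ : ℝ × ℝ →L[ℝ] ℝ) :
    (Lψ.comp (rayMapDeriv θ s)) (0, 1) = radialDeriv (Lψ (1, 0)) (Lψ (0, 1)) θ := by
  rw [ContinuousLinearMap.comp_apply, rayMapDeriv_apply]
  have e : ((-(0 * (s * sin θ)) + 1 * cos θ, 0 * (s * cos θ) + 1 * sin θ) : ℝ × ℝ)
      = (cos θ) • ((1 : ℝ), (0 : ℝ)) + (sin θ) • ((0 : ℝ), (1 : ℝ)) := by ext <;> simp
  rw [e, map_add, map_smul, map_smul, smul_eq_mul, smul_eq_mul]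
  unfold radialDeriv
  ring

/-! ## §3 The glued ray radius is differentiable on a panel, `ρ′ = −∂_θ/∂_s = −ρ·D_t/D_r` -/

section panelDeriv

variable {ψ : ℝ → ℝ → ℝ} {Rc Zc u a b s₁ s₂ : ℝ}

/-- On a panel the glued radius solves the level equation identically: `ψ(ray_θ ρ(θ)) = u` for `θ ∈ [a, b]`. [folklore] -/
theorem rayProfile_rayRadius_eq (hF : ContinuousOn (fun p : ℝ × ℝ => rayProfile ψ Rc Zc p.1 p.2) (Icc a b ×ˢ Icc s₁ s₂))
    (hs₁ : 0 < s₁) (hs : s₁ ≤ s₂)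
    (hin : ∀ θ ∈ Icc a b, ∀ s, 0 < s → s ≤ s₁ → rayProfile ψ Rc Zc θ s < u)
    (hmono : ∀ θ ∈ Icc a b, StrictMonoOn (rayProfile ψ Rc Zc θ) (Icc s₁ s₂))
    (hout : ∀ θ ∈ Icc a b, u < rayProfile ψ Rc Zc θ s₂) {θ : ℝ} (hθ : θ ∈ Icc a b) :
    rayProfile ψ Rc Zc θ (rayRadius ψ Rc Zc u θ) = u ∧ rayRadius ψ Rc Zc u θ ∈ Ioo s₁ s₂ := by
  have hcontθ : ContinuousOn (rayProfile ψ Rc Zc θ) (Icc s₁ s₂) := by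
    have hmap : MapsTo (fun s : ℝ => ((θ, s) : ℝ × ℝ)) (Icc s₁ s₂) (Icc a b ×ˢ Icc s₁ s₂) := fun s hs' => ⟨hθ, hs'⟩
    exact hF.comp (Continuous.prodMk continuous_const continuous_id).continuousOn hmap
  obtain ⟨hρI, hρu, -⟩ := rayRadius_spec hs₁ hs (hin θ hθ) hcontθ (hmono θ hθ) (hout θ hθ)
  exact ⟨hρu, hρI⟩

/-- **THE GLUED RAY RADIUS IS DIFFERENTIABLE ON THE PANEL (within `[a, b]`, endpoints included).**  Under the panel
hypotheses of `FluxSurfacePolarRayGlue` on `[a, b] × [s₁, s₂]`, if the uncurried ray profile `(θ, s) ↦ ψ(ray_θ s)` is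
Fréchet-differentiable at `(θ₀, ρ(θ₀))` with derivative `L` and `∂_s = L(0,1) ≠ 0`, then
`HasDerivWithinAt ρ (−L(1,0)/L(0,1)) [a, b] θ₀`, i.e. `ρ′(θ₀) = −∂_θψ(ray)/∂_sψ(ray)`. [folklore] -/
theorem hasDerivWithinAt_rayRadius
    (hF : ContinuousOn (fun p : ℝ × ℝ => rayProfile ψ Rc Zc p.1 p.2) (Icc a b ×ˢ Icc s₁ s₂))
    (hs₁ : 0 < s₁) (hs : s₁ ≤ s₂)
    (hin : ∀ θ ∈ Icc a b, ∀ s, 0 < s → s ≤ s₁ → rayProfile ψ Rc Zc θ s < u)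
    (hmono : ∀ θ ∈ Icc a b, StrictMonoOn (rayProfile ψ Rc Zc θ) (Icc s₁ s₂))
    (hout : ∀ θ ∈ Icc a b, u < rayProfile ψ Rc Zc θ s₂)
    {θ₀ : ℝ} (hθ₀ : θ₀ ∈ Icc a b) {L : ℝ × ℝ →L[ℝ] ℝ}
    (hL : HasFDerivAt (fun p : ℝ × ℝ => rayProfile ψ Rc Zc p.1 p.2) L (θ₀, rayRadius ψ Rc Zc u θ₀)) (hq : L (0, 1) ≠ 0) :
    HasDerivWithinAt (rayRadius ψ Rc Zc u) (-(L (1, 0)) / L (0, 1)) (Icc a b) θ₀ := by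
  have hcont : ContinuousWithinAt (rayRadius ψ Rc Zc u) (Icc a b) θ₀ :=
    continuousOn_rayRadius hF hs₁ hs hin hmono hout θ₀ hθ₀
  have hlevel : ∀ᶠ θ in 𝓝[Icc a b] θ₀, rayProfile ψ Rc Zc θ (rayRadius ψ Rc Zc u θ)
      = rayProfile ψ Rc Zc θ₀ (rayRadius ψ Rc Zc u θ₀) := by
    filter_upwards [self_mem_nhdsWithin] with θ hθ
    rw [(rayProfile_rayRadius_eq hF hs₁ hs hin hmono hout hθ).1, (rayProfile_rayRadius_eq hF hs₁ hs hin hmono hout hθ₀).1]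
  exact hasDerivWithinAt_of_implicit (F := fun p : ℝ × ℝ => rayProfile ψ Rc Zc p.1 p.2) hcont hlevel hL hq

/-- … at an INTERIOR point `θ₀ ∈ (a, b)` this is a plain derivative: `HasDerivAt ρ (−L(1,0)/L(0,1)) θ₀`. [folklore] -/
theorem hasDerivAt_rayRadius
    (hF : ContinuousOn (fun p : ℝ × ℝ => rayProfile ψ Rc Zc p.1 p.2) (Icc a b ×ˢ Icc s₁ s₂))
    (hs₁ : 0 < s₁) (hs : s₁ ≤ s₂)
    (hin : ∀ θ ∈ Icc a b, ∀ s, 0 < s → s ≤ s₁ → rayProfile ψ Rc Zc θ s < u)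
    (hmono : ∀ θ ∈ Icc a b, StrictMonoOn (rayProfile ψ Rc Zc θ) (Icc s₁ s₂))
    (hout : ∀ θ ∈ Icc a b, u < rayProfile ψ Rc Zc θ s₂)
    {θ₀ : ℝ} (hθ₀ : θ₀ ∈ Ioo a b) {L : ℝ × ℝ →L[ℝ] ℝ}
    (hL : HasFDerivAt (fun p : ℝ × ℝ => rayProfile ψ Rc Zc p.1 p.2) L (θ₀, rayRadius ψ Rc Zc u θ₀)) (hq : L (0, 1) ≠ 0) :
    HasDerivAt (rayRadius ψ Rc Zc u) (-(L (1, 0)) / L (0, 1)) θ₀ :=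
  (hasDerivWithinAt_rayRadius hF hs₁ hs hin hmono hout (Ioo_subset_Icc_self hθ₀) hL hq).hasDerivAt
    (Icc_mem_nhds hθ₀.1 hθ₀.2)

/-- **`ρ′ = −ρ·D_t/D_r` IN `ψ`'S VOCABULARY.**  If `ψ` itself is Fréchet-differentiable at the loop point `γ(θ₀)` with
derivative `Lψ` (partials `ψ_R = Lψ(1,0)`, `ψ_Z = Lψ(0,1)`) and the RADIAL derivative `D_r(θ₀) ≠ 0`, then on the panel
`HasDerivWithinAt ρ (−ρ(θ₀)·D_t(θ₀)/D_r(θ₀)) [a, b] θ₀` — the differentiated level condition `ρ′D_r + ρD_t = 0` of ★ #88's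
header, now for the GLUED `ρ`. [folklore] -/
theorem hasDerivWithinAt_rayRadius_of_psi
    (hF : ContinuousOn (fun p : ℝ × ℝ => rayProfile ψ Rc Zc p.1 p.2) (Icc a b ×ˢ Icc s₁ s₂))
    (hs₁ : 0 < s₁) (hs : s₁ ≤ s₂)
    (hin : ∀ θ ∈ Icc a b, ∀ s, 0 < s → s ≤ s₁ → rayProfile ψ Rc Zc θ s < u)
    (hmono : ∀ θ ∈ Icc a b, StrictMonoOn (rayProfile ψ Rc Zc θ) (Icc s₁ s₂))
    (hout : ∀ θ ∈ Icc a b, u < rayProfile ψ Rc Zc θ s₂)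
    {θ₀ : ℝ} (hθ₀ : θ₀ ∈ Icc a b) {Lψ : ℝ × ℝ →L[ℝ] ℝ}
    (hψ : HasFDerivAt (fun p : ℝ × ℝ => ψ p.1 p.2) Lψ (loop Rc Zc (rayRadius ψ Rc Zc u) θ₀))
    (hDr : radialDeriv (Lψ (1, 0)) (Lψ (0, 1)) θ₀ ≠ 0) :
    HasDerivWithinAt (rayRadius ψ Rc Zc u)
      (-(rayRadius ψ Rc Zc u θ₀ * tangentialDeriv (Lψ (1, 0)) (Lψ (0, 1)) θ₀) / radialDeriv (Lψ (1, 0)) (Lψ (0, 1)) θ₀)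
      (Icc a b) θ₀ := by
  have hψ' : HasFDerivAt (fun p : ℝ × ℝ => ψ p.1 p.2) Lψ (rayPoint Rc Zc θ₀ (rayRadius ψ Rc Zc u θ₀)) := by
    rw [← loop_eq_rayPoint]; exact hψ
  have hL := hasFDerivAt_rayProfile hψ'
  have h := hasDerivWithinAt_rayRadius hF hs₁ hs hin hmono hout hθ₀ hL (by rw [rayProfile_partial_s]; exact hDr)
  rw [rayProfile_partial_theta, rayProfile_partial_s] at h
  exact h

/-- … and at an interior point `θ₀ ∈ (a, b)`: `HasDerivAt ρ (−ρ·D_t/D_r) θ₀`. [folklore] -/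
theorem hasDerivAt_rayRadius_of_psi
    (hF : ContinuousOn (fun p : ℝ × ℝ => rayProfile ψ Rc Zc p.1 p.2) (Icc a b ×ˢ Icc s₁ s₂))
    (hs₁ : 0 < s₁) (hs : s₁ ≤ s₂)
    (hin : ∀ θ ∈ Icc a b, ∀ s, 0 < s → s ≤ s₁ → rayProfile ψ Rc Zc θ s < u)
    (hmono : ∀ θ ∈ Icc a b, StrictMonoOn (rayProfile ψ Rc Zc θ) (Icc s₁ s₂))
    (hout : ∀ θ ∈ Icc a b, u < rayProfile ψ Rc Zc θ s₂)
    {θ₀ : ℝ} (hθ₀ : θ₀ ∈ Ioo a b) {Lψ : ℝ × ℝ →L[ℝ] ℝ}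
    (hψ : HasFDerivAt (fun p : ℝ × ℝ => ψ p.1 p.2) Lψ (loop Rc Zc (rayRadius ψ Rc Zc u) θ₀))
    (hDr : radialDeriv (Lψ (1, 0)) (Lψ (0, 1)) θ₀ ≠ 0) :
    HasDerivAt (rayRadius ψ Rc Zc u)
      (-(rayRadius ψ Rc Zc u θ₀ * tangentialDeriv (Lψ (1, 0)) (Lψ (0, 1)) θ₀) / radialDeriv (Lψ (1, 0)) (Lψ (0, 1)) θ₀)
      θ₀ :=
  (hasDerivWithinAt_rayRadius_of_psi hF hs₁ hs hin hmono hout (Ioo_subset_Icc_self hθ₀) hψ hDr).hasDerivAt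
    (Icc_mem_nhds hθ₀.1 hθ₀.2)

/-- **THE LEVEL CONDITION, DIFFERENTIATED** (hypothesis `hlevel` of ★ #88's `safetyFactorE_eq_polar`): at an interior point of
the panel, `θ ↦ ψ(γ(θ))` along the glued loop has derivative `0` (it is constantly `u` on `[a, b]`). [folklore] -/
theorem hasDerivAt_level_rayRadius
    (hF : ContinuousOn (fun p : ℝ × ℝ => rayProfile ψ Rc Zc p.1 p.2) (Icc a b ×ˢ Icc s₁ s₂))
    (hs₁ : 0 < s₁) (hs : s₁ ≤ s₂)
    (hin : ∀ θ ∈ Icc a b, ∀ s, 0 < s → s ≤ s₁ → rayProfile ψ Rc Zc θ s < u)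
    (hmono : ∀ θ ∈ Icc a b, StrictMonoOn (rayProfile ψ Rc Zc θ) (Icc s₁ s₂))
    (hout : ∀ θ ∈ Icc a b, u < rayProfile ψ Rc Zc θ s₂) {θ₀ : ℝ} (hθ₀ : θ₀ ∈ Ioo a b) :
    HasDerivAt (fun t => ψ (loop Rc Zc (rayRadius ψ Rc Zc u) t).1 (loop Rc Zc (rayRadius ψ Rc Zc u) t).2) 0 θ₀ := by
  have hev : (fun t => ψ (loop Rc Zc (rayRadius ψ Rc Zc u) t).1 (loop Rc Zc (rayRadius ψ Rc Zc u) t).2)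
      =ᶠ[𝓝 θ₀] fun _ => u := by
    filter_upwards [Icc_mem_nhds hθ₀.1 hθ₀.2] with t ht
    exact (rayProfile_rayRadius_eq hF hs₁ hs hin hmono hout ht).1
  exact (hasDerivAt_const θ₀ u).congr_of_eventuallyEq hev

end panelDeriv

end PolarRay

end Summit.Ventures.FusionMHD.Models

end
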